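import Literature.MathematicalPhysics.QuantumFieldTheory.Balaban1983to89.B9Eq3117ConjugationDefects
import Literature.MathematicalPhysics.QuantumFieldTheory.Balaban1983to89.B9Eq3117LaplaceDerivCommutator
import Literature.MathematicalPhysics.QuantumFieldTheory.Balaban1983to89.B9Eq384RemainderLetters
import Literature.MathematicalPhysics.QuantumFieldTheory.Balaban1983to89.B9Eq34CovCurlVector

/-!
# `Balaban1983to89.B9Eq3117CommutatorBound` — T. Bałaban, *Propagators for lattice gauge theories in a background field*, Commun. Math. Phys. **99** (1985)
# 389–434 [Balaban1985BackgroundPropagators] (3.11) p. 392 (the current `J = D*η⁻²Im ∂U`), (3.35)–(3.36) p. 396 (the small-field class; *«later on we will have to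
# assume (3.36) also»*), (3.117)–(3.120) p. 419 (*«the error terms are small because the function J … is small, if U satisfies the condition (3.36)»*), Thm 3.13
# p. 426: **THE BOUND ON THE LATTICE COMMUTATOR `[D*_UD_U, D_{U,ν}]` ON THE SMALL-FIELD CLASS — `O(α)·‖D_Uf‖ + (2‖J_ν‖ + O(α²η))·‖f‖`, FROM THE PLAQUETTE WINDOW
# `‖U(∂p) − 1‖ ≤ αη²` AND THE CURRENT WINDOW `‖J‖ ≤ α`** — the quantitative half of this lineage's `B9Eq3117LaplaceDerivCommutator` (the exact identity: two plaquette
# defects per direction).  Pairing the two defects of the plaquettes ABOVE and BELOW the bond `⟨x, x+e_ν⟩` in each `(κ,ν)`-plane: their common leading term is the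
# conjugation defect of `R_{x,ν}f(x+e_ν)` by `P_a = U(∂p_{κν}(x))` and by `P_b = U_{x−e_κ,κ}⁻¹U(∂p_{νκ}(x−e_κ))U_{x−e_κ,κ}`, and `Σ_κ((P_a − 1) + (P_b − 1)) =
# −iη³J_ν(x) + O(dα²η⁴)` — THIS is where (3.36) enters the covariant Hessian row of STOREY H (`H3`); the remaining terms carry one covariant difference of `f`
# and one plaquette defect, `O(αη²)·η‖D_Uf‖`.  NE9 crux-team LEAF PROVER 01, gen 95.

statement-level skeleton of published theorems with citation tags; proofs where landed; nothing here is a claim about the Yang–Mills mass gap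

CITATION HEADER (lean-in-tree rule).  Audit cell `pub-balaban`, sub-cell `t4`, BINDER row NE9; filed by NE9 crux-team LEAF PROVER 01 (`b2b-balaban-t4-ne9-formalise-leaf-01`,
gen 95; bears_on: R4/N22).  Source READ first-hand (`paper:balaban1985-cmp99-background-propagators`, pp. 391–398, 419, 426).  The CONTENT is [folklore] finite algebra and
norm bookkeeping in the vocabulary of `B9Eq39Adjoint` (`R`, `plaqU`, `covDstar`, `divP`, `J`), `B9Eq37Insertion` (`imC`), `B9Eq310HessianOperator.adTransportW`,
`B7Prop1Explicit.U1`; REUSED BY NAME: `B9Eq3117Current.imC_conj`, `imC_plaqU_swap`, `B9Eq37Insertion.imC_inv`∕`imC_one`, `B9Eq39Adjoint.divP_eq_sum_of_antisymm`,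
`B9Eq34CovCurlVector.shift_comm`, `B9Eq3117LaplaceDerivCommutator.laplace_covDeriv_sub_covDeriv_laplace`.  Nothing printed is a hypothesis.

WHAT IS PROVED (sorry-free; proof lane — 0 `def`; the algebra in `𝔸` and `J_eq_sum` are the sibling `B9Eq3117ConjugationDefects`).
* Model transporters `R = Ad(U)`, `S = Ad(U⁻¹)` on the fibre `W ≃ 𝔸`: `unshift_shift_comm`, `adTransportW_adTransportW` (two transports = conjugation by the product), `conj_mul`,
  the two brackets of the commutator as conjugation defects (`bracket_above_eq` by `P_a = U(∂p_{κν}(x))`, `bracket_below_eq` by `P_b`, `plaq_below_eq`: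
  `P_b = U_{x−e_κ,κ}⁻¹U(∂p_{κν}(x−e_κ))⁻¹U_{x−e_κ,κ}`), `adTransportW_inv_adTransportW'` (`SR = 1`).
* **`norm_commutator_sum_le`** ∕ **`norm_laplace_covDeriv_comm_le`**: for `U(b) ∈ U1`, `‖U(∂p_{κν}(x)) − 1‖ ≤ αη²` (all `κ, ν, x` — both orientations) and contractions `R`, `S`,
  every `f`, `ν`, `x`: `‖(D*_UD_U(D_Uf(·,ν)))(x) − (D_U(D*_UD_Uf))(x,ν)‖ ≤ M_φM_φ′·[(2‖J_ν(x)‖ + 8dα²η)·‖f(x+e_ν)‖ + 2α·Σ_κ(‖(D_Uf)(x+e_ν,κ)‖ + ‖(D_Uf)(x+e_ν−e_κ,κ)‖)]`.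
HONEST SCOPE.  [folklore] algebra + norm bookkeeping on the model's transporters; the smallness `‖J‖ ≤ α` is a HYPOTHESIS of the consumer (the (T4E) block's `_hJ`), not derived
here (print derives it from (3.36) in a cube gauge; tree: `B9Eq336CurrentBound`).  No estimate of print's propagators; NOT summit progress (cell pub-balaban: NE9 NOT PRINTED ∕
NOT PROVED; «NE9 ⇐ the named binders»; row WALLED ON A MODEL (O-NE9-1; #5 UNRULED); spine PROVED 0∕9; rung (B)+1 finite T⁴ — NOT infinite volume, NOT mass gap, NOT BetaPertH,
NOT Clay).  NEW file; nothing modified.  Net new unproved facts: 0.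
-/

noncomputable section

open scoped BigOperators
open Complex

namespace Literature.MathematicalPhysics.QuantumFieldTheory.Balaban1983to89.B9Eq3117CommutatorBound

open B4Sect5Torus (TSite)
open B9SectCLatticeCarrier (Bond shift unshift shift_unshift unshift_shift)
open B9Eq33CovDerivVector (covDeriv covDiv covDeriv_apply_dir shiftEquiv)
open B9Eq37Insertion (imC imC_inv)
open B9Eq39Adjoint (R R_def plaqU J)
open B9Eq3117Current (imC_conj)
open B9Eq310HessianOperator (adTransportW adTransportW_apply)
open B7Prop1Explicit (U1 mem_U1 norm_inv_sub_one_le)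
open B9Eq34CovCurlVector (shift_comm)
open B9Eq3117ConjugationDefects (norm_conj_sub_self_le norm_sum_conj_sub_self_le J_eq_sum)

/-! ## The commutator on the model's transporters `R = Ad(U)`, `S = Ad(U⁻¹)` -/

section Model

variable {d : ℕ} {Pd : Fin d → ℕ} {𝔸 : Type*} [NormedRing 𝔸] [NormedAlgebra ℂ 𝔸] [NormOneClass 𝔸]
  {W : Type*} [NormedAddCommGroup W] [InnerProductSpace ℂ W] (φ : W ≃ₗ[ℂ] 𝔸)

/-- `unshift κ (shift ν x) = shift ν (unshift κ x)` on the torus. [folklore] [cite: Balaban1985BackgroundPropagators, (3.4) p.391] -/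
theorem unshift_shift_comm (κ ν : Fin d) (x : TSite d Pd) : unshift κ (shift ν x) = shift ν (unshift κ x) := by
  have h := shift_comm κ ν (unshift κ x)
  rw [shift_unshift] at h
  rw [← h, unshift_shift]

omit [NormOneClass 𝔸] in
/-- Two transports compose to the conjugation by the product. [folklore] [cite: Balaban1985BackgroundPropagators, p.390] -/
theorem adTransportW_adTransportW (V V' : Bond d Pd → 𝔸ˣ) (b b' : Bond d Pd) (w : W) :
    adTransportW φ V b (adTransportW φ V' b' w) = φ.symm (((V b * V' b' : 𝔸ˣ) : 𝔸) * φ w * (((V b * V' b')⁻¹ : 𝔸ˣ) : 𝔸)) := by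
  rw [adTransportW_apply, adTransportW_apply, LinearEquiv.apply_symm_apply, Units.val_mul, mul_inv_rev, Units.val_mul]
  congr 1
  simp only [mul_assoc]

omit [NormedAlgebra ℂ 𝔸] [NormOneClass 𝔸] in
/-- Conjugation by a product, split. [folklore] [cite: Balaban1985BackgroundPropagators, p.390] -/
theorem conj_mul (P V : 𝔸ˣ) (X : 𝔸) :
    ((P * V : 𝔸ˣ) : 𝔸) * X * (((P * V)⁻¹ : 𝔸ˣ) : 𝔸) = (P : 𝔸) * ((V : 𝔸) * X * ((V⁻¹ : 𝔸ˣ) : 𝔸)) * ((P⁻¹ : 𝔸ˣ) : 𝔸) := by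
  rw [Units.val_mul, mul_inv_rev, Units.val_mul]; simp only [mul_assoc]

omit [NormOneClass 𝔸] in
/-- **THE DEFECT OF THE PLAQUETTE ABOVE**: with `V₁ = U_{x,ν}U_{x+e_ν,κ}`, `Y = V₁·φw·V₁⁻¹` and `P_a = U(∂p_{κν}(x))` (`B9Eq39Adjoint.plaqU κ ν x`):
`R_{x,ν}R_{x+e_ν,κ}w − R_{x,κ}R_{x+e_κ,ν}w = −φ⁻¹(P_aYP_a⁻¹ − Y)`. [folklore] [cite: Balaban1985BackgroundPropagators, (3.1) p.390, (3.4) p.391] -/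
theorem bracket_above_eq (U : Bond d Pd → 𝔸ˣ) (κ ν : Fin d) (x : TSite d Pd) (w : W) :
    adTransportW φ U (x, ν) (adTransportW φ U (shift ν x, κ) w) - adTransportW φ U (x, κ) (adTransportW φ U (shift κ x, ν) w) =
      -(φ.symm (((plaqU (fun μ => shiftEquiv (Pd := Pd) μ) (fun μ y => U (y, μ)) κ ν x : 𝔸ˣ) : 𝔸) *
          ((((U (x, ν) * U (shift ν x, κ) : 𝔸ˣ) : 𝔸) * φ w * (((U (x, ν) * U (shift ν x, κ))⁻¹ : 𝔸ˣ) : 𝔸))) *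
          (((plaqU (fun μ => shiftEquiv (Pd := Pd) μ) (fun μ y => U (y, μ)) κ ν x)⁻¹ : 𝔸ˣ) : 𝔸) -
        (((U (x, ν) * U (shift ν x, κ) : 𝔸ˣ) : 𝔸) * φ w * (((U (x, ν) * U (shift ν x, κ))⁻¹ : 𝔸ˣ) : 𝔸)))) := by
  have hV : U (x, κ) * U (shift κ x, ν) = plaqU (fun μ => shiftEquiv (Pd := Pd) μ) (fun μ y => U (y, μ)) κ ν x * (U (x, ν) * U (shift ν x, κ)) := by
    rw [plaqU]
    show U (x, κ) * U (shift κ x, ν) = U (x, κ) * U (shift κ x, ν) * (U (shift ν x, κ))⁻¹ * (U (x, ν))⁻¹ * (U (x, ν) * U (shift ν x, κ))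
    group
  have h1 := adTransportW_adTransportW φ U U (x, ν) (shift ν x, κ) w
  have h2 : adTransportW φ U (x, κ) (adTransportW φ U (shift κ x, ν) w) =
      φ.symm (((plaqU (fun μ => shiftEquiv (Pd := Pd) μ) (fun μ y => U (y, μ)) κ ν x : 𝔸ˣ) : 𝔸) *
          ((((U (x, ν) * U (shift ν x, κ) : 𝔸ˣ) : 𝔸) * φ w * (((U (x, ν) * U (shift ν x, κ))⁻¹ : 𝔸ˣ) : 𝔸))) *
          (((plaqU (fun μ => shiftEquiv (Pd := Pd) μ) (fun μ y => U (y, μ)) κ ν x)⁻¹ : 𝔸ˣ) : 𝔸)) := by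
    rw [adTransportW_adTransportW, hV, conj_mul]
  rw [h1, h2, map_sub]
  abel

omit [NormOneClass 𝔸] in
/-- **THE DEFECT OF THE PLAQUETTE BELOW**: with `V₃ = U_{x,ν}U_{x+e_ν−e_κ,κ}⁻¹`, `Y′ = V₃·φw·V₃⁻¹`, `V₄ = U_{x−e_κ,κ}⁻¹U_{x−e_κ,ν}` and `P_b = V₄V₃⁻¹`:
`R_{x,ν}S_{x+e_ν−e_κ,κ}w − S_{x−e_κ,κ}R_{x−e_κ,ν}w = −φ⁻¹(P_bY′P_b⁻¹ − Y′)` (the point `x+e_ν−e_κ` written both ways). [folklore]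
[cite: Balaban1985BackgroundPropagators, (3.1) p.390, (3.4) p.391] -/
theorem bracket_below_eq (U : Bond d Pd → 𝔸ˣ) (κ ν : Fin d) (x : TSite d Pd) (w : W) :
    adTransportW φ U (x, ν) (adTransportW φ (fun b => (U b)⁻¹) (unshift κ (shift ν x), κ) w) -
        adTransportW φ (fun b => (U b)⁻¹) (unshift κ x, κ) (adTransportW φ U (unshift κ x, ν) w) =
      -(φ.symm ((((U (unshift κ x, κ))⁻¹ * U (unshift κ x, ν) * (U (x, ν) * (U (unshift κ (shift ν x), κ))⁻¹)⁻¹ : 𝔸ˣ) : 𝔸) *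
          ((((U (x, ν) * (U (unshift κ (shift ν x), κ))⁻¹ : 𝔸ˣ) : 𝔸) * φ w * (((U (x, ν) * (U (unshift κ (shift ν x), κ))⁻¹)⁻¹ : 𝔸ˣ) : 𝔸))) *
          ((((U (unshift κ x, κ))⁻¹ * U (unshift κ x, ν) * (U (x, ν) * (U (unshift κ (shift ν x), κ))⁻¹)⁻¹)⁻¹ : 𝔸ˣ) : 𝔸) -
        (((U (x, ν) * (U (unshift κ (shift ν x), κ))⁻¹ : 𝔸ˣ) : 𝔸) * φ w * (((U (x, ν) * (U (unshift κ (shift ν x), κ))⁻¹)⁻¹ : 𝔸ˣ) : 𝔸)))) := by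
  have hV : (U (unshift κ x, κ))⁻¹ * U (unshift κ x, ν) =
      ((U (unshift κ x, κ))⁻¹ * U (unshift κ x, ν) * (U (x, ν) * (U (unshift κ (shift ν x), κ))⁻¹)⁻¹) * (U (x, ν) * (U (unshift κ (shift ν x), κ))⁻¹) := by
    group
  have h1 := adTransportW_adTransportW φ U (fun b => (U b)⁻¹) (x, ν) (unshift κ (shift ν x), κ) w
  have h2 : adTransportW φ (fun b => (U b)⁻¹) (unshift κ x, κ) (adTransportW φ U (unshift κ x, ν) w) =
      φ.symm ((((U (unshift κ x, κ))⁻¹ * U (unshift κ x, ν) * (U (x, ν) * (U (unshift κ (shift ν x), κ))⁻¹)⁻¹ : 𝔸ˣ) : 𝔸) *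
          ((((U (x, ν) * (U (unshift κ (shift ν x), κ))⁻¹ : 𝔸ˣ) : 𝔸) * φ w * (((U (x, ν) * (U (unshift κ (shift ν x), κ))⁻¹)⁻¹ : 𝔸ˣ) : 𝔸))) *
          ((((U (unshift κ x, κ))⁻¹ * U (unshift κ x, ν) * (U (x, ν) * (U (unshift κ (shift ν x), κ))⁻¹)⁻¹)⁻¹ : 𝔸ˣ) : 𝔸)) := by
    rw [adTransportW_adTransportW, ← conj_mul, ← hV]
  rw [h1, h2, map_sub]
  abel

omit [NormedAlgebra ℂ 𝔸] [NormOneClass 𝔸] in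
/-- **The plaquette below as a transported plaquette**: `P_b = U_{x−e_κ,κ}⁻¹·U(∂p_{κν}(x−e_κ))⁻¹·U_{x−e_κ,κ}`. [folklore]
[cite: Balaban1985BackgroundPropagators, (3.1) p.390] -/
theorem plaq_below_eq (U : Bond d Pd → 𝔸ˣ) (κ ν : Fin d) (x : TSite d Pd) :
    (U (unshift κ x, κ))⁻¹ * U (unshift κ x, ν) * (U (x, ν) * (U (unshift κ (shift ν x), κ))⁻¹)⁻¹ =
      (U (unshift κ x, κ))⁻¹ * (plaqU (fun μ => shiftEquiv (Pd := Pd) μ) (fun μ y => U (y, μ)) κ ν (unshift κ x))⁻¹ * U (unshift κ x, κ) := by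
  rw [plaqU]
  show (U (unshift κ x, κ))⁻¹ * U (unshift κ x, ν) * (U (x, ν) * (U (unshift κ (shift ν x), κ))⁻¹)⁻¹ =
    (U (unshift κ x, κ))⁻¹ * (U (unshift κ x, κ) * U (shift κ (unshift κ x), ν) * (U (shift ν (unshift κ x), κ))⁻¹ * (U (unshift κ x, ν))⁻¹)⁻¹ *
      U (unshift κ x, κ)
  rw [shift_unshift, unshift_shift_comm]
  group

omit [NormOneClass 𝔸] in
/-- `S_b(R_bw) = w` for `S = Ad(U⁻¹)`, `R = Ad(U)`. [folklore] [cite: Balaban1985BackgroundPropagators, p.390] -/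
theorem adTransportW_inv_adTransportW' (U : Bond d Pd → 𝔸ˣ) (b : Bond d Pd) (w : W) :
    adTransportW φ (fun b => (U b)⁻¹) b (adTransportW φ U b w) = w := by
  rw [adTransportW_adTransportW, inv_mul_cancel, inv_one, Units.val_one, one_mul, mul_one, LinearEquiv.symm_apply_apply]

variable {Mφ Mφ' : ℝ} (hφ : ∀ w, ‖φ w‖ ≤ Mφ * ‖w‖) (hφ' : ∀ X, ‖φ.symm X‖ ≤ Mφ' * ‖X‖) (hMφ : 0 ≤ Mφ) (hMφ' : 0 ≤ Mφ')

include hφ hφ' hMφ hMφ' in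
/-- **THE BOUND ON THE TWO-PLAQUETTE SUM OF THE COMMUTATOR** (the right side of `B9Eq3117LaplaceDerivCommutator.laplace_covDeriv_sub_covDeriv_laplace` at the model
transporters `R = Ad(U)`, `S = Ad(U⁻¹)`, `c = η⁻¹`): for `U(b) ∈ U1`, `‖U(∂p_{κν}(x)) − 1‖ ≤ αη²` (all `κ, ν, x`) and contractions `R`, `S`,
`‖η⁻³Σ_κ(bracket above + bracket below)‖ ≤ M_φM_φ′·[(2‖J_ν(x)‖ + 8dα²η)·‖f(x+e_ν)‖ + 2α·Σ_κ(‖(D_Uf)(x+e_ν,κ)‖ + ‖(D_Uf)(x+e_ν−e_κ,κ)‖)]`, `J` the current (3.11).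
[folklore] [cite: Balaban1985BackgroundPropagators, (3.11) p.392, (3.35)–(3.36) p.396, (3.117)–(3.120) p.419] -/
theorem norm_commutator_sum_le (U : Bond d Pd → 𝔸ˣ) (hUb : ∀ b, U b ∈ U1 𝔸) {η α : ℝ} (hη : 0 < η) (hα : 0 ≤ α)
    (hpl : ∀ κ ν x, ‖((plaqU (fun μ => shiftEquiv (Pd := Pd) μ) (fun μ y => U (y, μ)) κ ν x : 𝔸ˣ) : 𝔸) - 1‖ ≤ α * η ^ 2)
    (hRn : ∀ b w, ‖adTransportW φ U b w‖ ≤ ‖w‖) (hSn : ∀ b w, ‖adTransportW φ (fun b => (U b)⁻¹) b w‖ ≤ ‖w‖)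
    (f : TSite d Pd → W) (ν : Fin d) (x : TSite d Pd) :
    ‖((η : ℂ)⁻¹) • (((η : ℂ)⁻¹) • (((η : ℂ)⁻¹) • ∑ κ,
        ((adTransportW φ U (x, ν) (adTransportW φ U (shift ν x, κ) (f (shift κ (shift ν x)))) -
            adTransportW φ U (x, κ) (adTransportW φ U (shift κ x, ν) (f (shift ν (shift κ x))))) +
         (adTransportW φ U (x, ν) (adTransportW φ (fun b => (U b)⁻¹) (unshift κ (shift ν x), κ) (f (unshift κ (shift ν x)))) -
            adTransportW φ (fun b => (U b)⁻¹) (unshift κ x, κ) (adTransportW φ U (unshift κ x, ν) (f (shift ν (unshift κ x))))))))‖ ≤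
      Mφ * Mφ' * ((2 * ‖J (fun μ => shiftEquiv (Pd := Pd) μ) (fun μ y => U (y, μ)) η ν x‖ + 8 * d * α ^ 2 * η) * ‖f (shift ν x)‖ +
        2 * α * ∑ κ, (‖covDeriv ((η : ℂ)⁻¹) (adTransportW φ U) f (shift ν x, κ)‖ +
          ‖covDeriv ((η : ℂ)⁻¹) (adTransportW φ U) f (unshift κ (shift ν x), κ)‖)) := by
  have hηc : (η : ℂ) ≠ 0 := by exact_mod_cast hη.ne'
  have hcη : (η : ℂ) * ((η : ℂ)⁻¹) = 1 := mul_inv_cancel₀ hηc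
  have hnc : ‖((η : ℂ)⁻¹)‖ = η⁻¹ := by rw [norm_inv, Complex.norm_real, Real.norm_of_nonneg hη.le]
  set y := shift ν x with hy
  set Df := covDeriv ((η : ℂ)⁻¹) (adTransportW φ U) f with hDf
  -- the two covariant-difference rewrites
  have hD1 : ∀ κ, adTransportW φ U (y, κ) (f (shift κ y)) = f y + (η : ℂ) • Df (y, κ) := by
    intro κ; rw [hDf, covDeriv_apply_dir, smul_smul, hcη, one_smul]; abel
  have hD2 : ∀ κ, adTransportW φ (fun b => (U b)⁻¹) (unshift κ y, κ) (f (unshift κ y)) =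
      f y - (η : ℂ) • adTransportW φ (fun b => (U b)⁻¹) (unshift κ y, κ) (Df (unshift κ y, κ)) := by
    intro κ
    rw [hDf, covDeriv_apply_dir, shift_unshift, map_smul, map_sub, adTransportW_inv_adTransportW', smul_smul, hcη, one_smul]
    abel
  -- the 𝔸-objects
  set Y0 : 𝔸 := φ (adTransportW φ U (x, ν) (f y)) with hY0
  set Z1 : Fin d → 𝔸 := fun κ => φ (adTransportW φ U (x, ν) (Df (y, κ))) with hZ1
  set Z2 : Fin d → 𝔸 := fun κ => φ (adTransportW φ U (x, ν) (adTransportW φ (fun b => (U b)⁻¹) (unshift κ y, κ) (Df (unshift κ y, κ)))) with hZ2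
  set Pa : Fin d → 𝔸ˣ := fun κ => plaqU (fun μ => shiftEquiv (Pd := Pd) μ) (fun μ y => U (y, μ)) κ ν x with hPa
  set Pb : Fin d → 𝔸ˣ := fun κ => (U (unshift κ x, κ))⁻¹ * U (unshift κ x, ν) * (U (x, ν) * (U (unshift κ y, κ))⁻¹)⁻¹ with hPb
  -- the full conjugated elements and their expansion
  have hYa : ∀ κ, (((U (x, ν) * U (y, κ) : 𝔸ˣ) : 𝔸) * φ (f (shift κ y)) * (((U (x, ν) * U (y, κ))⁻¹ : 𝔸ˣ) : 𝔸)) = Y0 + (η : ℂ) • Z1 κ := by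
    intro κ
    have h := adTransportW_adTransportW φ U U (x, ν) (y, κ) (f (shift κ y))
    rw [hD1, map_add, map_smul] at h
    have h2 := congrArg φ h
    rw [LinearEquiv.apply_symm_apply, map_add, map_smul] at h2
    exact h2.symm
  have hYb : ∀ κ, (((U (x, ν) * (U (unshift κ y, κ))⁻¹ : 𝔸ˣ) : 𝔸) * φ (f (unshift κ y)) * (((U (x, ν) * (U (unshift κ y, κ))⁻¹)⁻¹ : 𝔸ˣ) : 𝔸)) =
      Y0 - (η : ℂ) • Z2 κ := by
    intro κ
    have h := adTransportW_adTransportW φ U (fun b => (U b)⁻¹) (x, ν) (unshift κ y, κ) (f (unshift κ y))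
    rw [hD2, map_sub, map_smul] at h
    have h2 := congrArg φ h
    rw [LinearEquiv.apply_symm_apply, map_sub, map_smul] at h2
    exact h2.symm
  have conj_expand : ∀ (P : 𝔸ˣ) (A B : 𝔸) (t : ℂ), (P : 𝔸) * (A + t • B) * ((P⁻¹ : 𝔸ˣ) : 𝔸) - (A + t • B) =
      ((P : 𝔸) * A * ((P⁻¹ : 𝔸ˣ) : 𝔸) - A) + t • ((P : 𝔸) * B * ((P⁻¹ : 𝔸ˣ) : 𝔸) - B) := by
    intro P A B t; rw [mul_add, add_mul, mul_smul_comm, smul_mul_assoc, smul_sub]; abel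
  -- per-κ identity
  have hterm : ∀ κ, (adTransportW φ U (x, ν) (adTransportW φ U (shift ν x, κ) (f (shift κ (shift ν x)))) -
            adTransportW φ U (x, κ) (adTransportW φ U (shift κ x, ν) (f (shift ν (shift κ x))))) +
         (adTransportW φ U (x, ν) (adTransportW φ (fun b => (U b)⁻¹) (unshift κ (shift ν x), κ) (f (unshift κ (shift ν x)))) -
            adTransportW φ (fun b => (U b)⁻¹) (unshift κ x, κ) (adTransportW φ U (unshift κ x, ν) (f (shift ν (unshift κ x))))) =
      -(φ.symm ((((Pa κ : 𝔸) * Y0 * (((Pa κ)⁻¹ : 𝔸ˣ) : 𝔸) - Y0) + ((Pb κ : 𝔸) * Y0 * (((Pb κ)⁻¹ : 𝔸ˣ) : 𝔸) - Y0)) +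
        (η : ℂ) • (((Pa κ : 𝔸) * Z1 κ * (((Pa κ)⁻¹ : 𝔸ˣ) : 𝔸) - Z1 κ) - ((Pb κ : 𝔸) * Z2 κ * (((Pb κ)⁻¹ : 𝔸ˣ) : 𝔸) - Z2 κ)))) := by
    intro κ
    rw [shift_comm ν κ x, ← unshift_shift_comm κ ν x, ← hy, bracket_above_eq, bracket_below_eq, hYa, hYb,
      conj_expand, show Y0 - (η : ℂ) • Z2 κ = Y0 + (-(η : ℂ)) • Z2 κ by rw [neg_smul, sub_eq_add_neg], conj_expand,
      ← neg_add, ← map_add]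
    congr 2
    simp only [hPa, hPb, neg_smul, smul_sub]
    abel
  -- U1 bookkeeping
  have hPaU : ∀ κ, Pa κ ∈ U1 𝔸 := fun κ =>
    (U1 𝔸).mul_mem ((U1 𝔸).mul_mem ((U1 𝔸).mul_mem (hUb _) (hUb _)) ((U1 𝔸).inv_mem (hUb _))) ((U1 𝔸).inv_mem (hUb _))
  have hPbU : ∀ κ, Pb κ ∈ U1 𝔸 := fun κ =>
    (U1 𝔸).mul_mem ((U1 𝔸).mul_mem ((U1 𝔸).inv_mem (hUb _)) (hUb _)) ((U1 𝔸).inv_mem ((U1 𝔸).mul_mem (hUb _) ((U1 𝔸).inv_mem (hUb _))))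
  have hPa1 : ∀ κ, ‖(Pa κ : 𝔸) - 1‖ ≤ α * η ^ 2 := fun κ => hpl κ ν x
  have hPb1 : ∀ κ, ‖(Pb κ : 𝔸) - 1‖ ≤ α * η ^ 2 := by
    intro κ
    have hQU : plaqU (fun μ => shiftEquiv (Pd := Pd) μ) (fun μ y => U (y, μ)) κ ν (unshift κ x) ∈ U1 𝔸 :=
      (U1 𝔸).mul_mem ((U1 𝔸).mul_mem ((U1 𝔸).mul_mem (hUb _) (hUb _)) ((U1 𝔸).inv_mem (hUb _))) ((U1 𝔸).inv_mem (hUb _))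
    have e : (Pb κ : 𝔸) - 1 = (((U (unshift κ x, κ))⁻¹ : 𝔸ˣ) : 𝔸) *
        ((((plaqU (fun μ => shiftEquiv (Pd := Pd) μ) (fun μ y => U (y, μ)) κ ν (unshift κ x))⁻¹ : 𝔸ˣ) : 𝔸) - 1) * (U (unshift κ x, κ) : 𝔸) := by
      rw [hPb]; dsimp only; rw [hy, plaq_below_eq, Units.val_mul, Units.val_mul, mul_sub, sub_mul, mul_one, Units.inv_mul]
    rw [e]
    obtain ⟨hu1, hu2⟩ := mem_U1.1 (hUb (unshift κ x, κ))
    calc _ ≤ ‖(((U (unshift κ x, κ))⁻¹ : 𝔸ˣ) : 𝔸) *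
          ((((plaqU (fun μ => shiftEquiv (Pd := Pd) μ) (fun μ y => U (y, μ)) κ ν (unshift κ x))⁻¹ : 𝔸ˣ) : 𝔸) - 1)‖ * ‖(U (unshift κ x, κ) : 𝔸)‖ :=
          norm_mul_le _ _
      _ ≤ (‖(((U (unshift κ x, κ))⁻¹ : 𝔸ˣ) : 𝔸)‖ *
          ‖(((plaqU (fun μ => shiftEquiv (Pd := Pd) μ) (fun μ y => U (y, μ)) κ ν (unshift κ x))⁻¹ : 𝔸ˣ) : 𝔸) - 1‖) * 1 :=
          mul_le_mul (norm_mul_le _ _) hu1 (norm_nonneg _) (by positivity)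
      _ ≤ (1 * (α * η ^ 2)) * 1 := by
          gcongr
          exact (norm_inv_sub_one_le hQU).trans (hpl κ ν (unshift κ x))
      _ = α * η ^ 2 := by ring
  -- the imaginary parts sum to the current
  have hImb : ∀ κ, imC (Pb κ) = -((((U (unshift κ x, κ))⁻¹ : 𝔸ˣ) : 𝔸) *
      imC (plaqU (fun μ => shiftEquiv (Pd := Pd) μ) (fun μ y => U (y, μ)) κ ν (unshift κ x)) * (U (unshift κ x, κ) : 𝔸)) := by
    intro κ
    rw [hPb]; dsimp only
    rw [hy, plaq_below_eq, show (U (unshift κ x, κ))⁻¹ * (plaqU (fun μ => shiftEquiv (Pd := Pd) μ) (fun μ y => U (y, μ)) κ ν (unshift κ x))⁻¹ *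
        U (unshift κ x, κ) = (U (unshift κ x, κ))⁻¹ * (plaqU (fun μ => shiftEquiv (Pd := Pd) μ) (fun μ y => U (y, μ)) κ ν (unshift κ x))⁻¹ *
        ((U (unshift κ x, κ))⁻¹)⁻¹ by rw [inv_inv], imC_conj, R_def, inv_inv, imC_inv, mul_neg, neg_mul]
  have hImSum : ∑ i, imC (Sum.elim Pa Pb i) = -((η : ℂ) ^ 3 • J (fun μ => shiftEquiv (Pd := Pd) μ) (fun μ y => U (y, μ)) η ν x) := by
    rw [Fintype.sum_sum_type, J_eq_sum, smul_smul, ← mul_pow, hcη, one_pow, one_smul]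
    simp only [Sum.elim_inl, Sum.elim_inr, hImb, hPa]
    rw [← Finset.sum_add_distrib, ← Finset.sum_neg_distrib]
    refine Finset.sum_congr rfl fun κ _ => ?_
    abel
  -- norms of the 𝔸-objects
  have hY0n : ‖Y0‖ ≤ Mφ * ‖f y‖ := (hφ _).trans (mul_le_mul_of_nonneg_left (hRn _ _) hMφ)
  have hZ1n : ∀ κ, ‖Z1 κ‖ ≤ Mφ * ‖Df (y, κ)‖ := fun κ => (hφ _).trans (mul_le_mul_of_nonneg_left (hRn _ _) hMφ)
  have hZ2n : ∀ κ, ‖Z2 κ‖ ≤ Mφ * ‖Df (unshift κ y, κ)‖ := fun κ =>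
    (hφ _).trans (mul_le_mul_of_nonneg_left ((hRn _ _).trans (hSn _ _)) hMφ)
  -- the lead and the rest
  have hLead : ‖∑ κ, (((Pa κ : 𝔸) * Y0 * (((Pa κ)⁻¹ : 𝔸ˣ) : 𝔸) - Y0) + ((Pb κ : 𝔸) * Y0 * (((Pb κ)⁻¹ : 𝔸ˣ) : 𝔸) - Y0))‖ ≤
      (2 * (η ^ 3 * ‖J (fun μ => shiftEquiv (Pd := Pd) μ) (fun μ y => U (y, μ)) η ν x‖) + 8 * d * (α * η ^ 2) ^ 2) * (Mφ * ‖f y‖) := by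
    have h := norm_sum_conj_sub_self_le (Sum.elim Pa Pb) (ε := α * η ^ 2)
      (fun i => by rcases i with κ | κ <;> simp only [Sum.elim_inl, Sum.elim_inr] <;> first | exact hPa1 κ | exact hPb1 κ)
      (fun i => by rcases i with κ | κ <;> simp only [Sum.elim_inl, Sum.elim_inr] <;> first | exact (mem_U1.1 (hPaU κ)).2 | exact (mem_U1.1 (hPbU κ)).2) Y0
    rw [Fintype.sum_sum_type] at h
    simp only [Sum.elim_inl, Sum.elim_inr] at h
    rw [← Finset.sum_add_distrib, hImSum, norm_neg, norm_smul, norm_pow, Complex.norm_real, Real.norm_of_nonneg hη.le,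
      Fintype.card_sum, Fintype.card_fin] at h
    refine h.trans ?_
    have hJ0 : 0 ≤ 2 * (η ^ 3 * ‖J (fun μ => shiftEquiv (Pd := Pd) μ) (fun μ y => U (y, μ)) η ν x‖) + 8 * d * (α * η ^ 2) ^ 2 := by positivity
    calc _ ≤ (2 * (η ^ 3 * ‖J (fun μ => shiftEquiv (Pd := Pd) μ) (fun μ y => U (y, μ)) η ν x‖) + 8 * d * (α * η ^ 2) ^ 2) * ‖Y0‖ := by
          apply le_of_eq; congr 1; push_cast; ring
      _ ≤ _ := mul_le_mul_of_nonneg_left hY0n hJ0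
  have hRest : ‖∑ κ, (η : ℂ) • (((Pa κ : 𝔸) * Z1 κ * (((Pa κ)⁻¹ : 𝔸ˣ) : 𝔸) - Z1 κ) - ((Pb κ : 𝔸) * Z2 κ * (((Pb κ)⁻¹ : 𝔸ˣ) : 𝔸) - Z2 κ))‖ ≤
      ∑ κ, η * (2 * (α * η ^ 2) * (Mφ * ‖Df (y, κ)‖) + 2 * (α * η ^ 2) * (Mφ * ‖Df (unshift κ y, κ)‖)) := by
    refine (norm_sum_le _ _).trans (Finset.sum_le_sum fun κ _ => ?_)
    rw [norm_smul, Complex.norm_real, Real.norm_of_nonneg hη.le]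
    refine mul_le_mul_of_nonneg_left ((norm_sub_le _ _).trans (add_le_add ?_ ?_)) hη.le
    · exact (norm_conj_sub_self_le (Pa κ) (mem_U1.1 (hPaU κ)).2 (Z1 κ)).trans
        (by gcongr; exacts [hPa1 κ, hZ1n κ])
    · exact (norm_conj_sub_self_le (Pb κ) (mem_U1.1 (hPbU κ)).2 (Z2 κ)).trans
        (by gcongr; exacts [hPb1 κ, hZ2n κ])
  -- assembly
  rw [Finset.sum_congr rfl fun κ _ => hterm κ, Finset.sum_neg_distrib, ← map_sum, smul_neg, smul_neg, smul_neg, norm_neg,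
    norm_smul, norm_smul, norm_smul, hnc, Finset.sum_add_distrib]
  have hφs := hφ' (∑ κ, (((Pa κ : 𝔸) * Y0 * (((Pa κ)⁻¹ : 𝔸ˣ) : 𝔸) - Y0) + ((Pb κ : 𝔸) * Y0 * (((Pb κ)⁻¹ : 𝔸ˣ) : 𝔸) - Y0)) +
    ∑ κ, (η : ℂ) • (((Pa κ : 𝔸) * Z1 κ * (((Pa κ)⁻¹ : 𝔸ˣ) : 𝔸) - Z1 κ) - ((Pb κ : 𝔸) * Z2 κ * (((Pb κ)⁻¹ : 𝔸ˣ) : 𝔸) - Z2 κ)))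
  have hsum2 := (norm_add_le _ _).trans (add_le_add hLead hRest)
  have hη3 : (0 : ℝ) < η⁻¹ := inv_pos.2 hη
  calc _ ≤ η⁻¹ * (η⁻¹ * (η⁻¹ * (Mφ' * ((2 * (η ^ 3 * ‖J (fun μ => shiftEquiv (Pd := Pd) μ) (fun μ y => U (y, μ)) η ν x‖) + 8 * d * (α * η ^ 2) ^ 2) * (Mφ * ‖f y‖) +
        ∑ κ, η * (2 * (α * η ^ 2) * (Mφ * ‖Df (y, κ)‖) + 2 * (α * η ^ 2) * (Mφ * ‖Df (unshift κ y, κ)‖)))))) := by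
        gcongr
        exact hφs.trans (mul_le_mul_of_nonneg_left hsum2 hMφ')
    _ = _ := by
        set nJ := ‖J (fun μ => shiftEquiv (Pd := Pd) μ) (fun μ y => U (y, μ)) η ν x‖ with hnJ
        have hne : η ≠ 0 := hη.ne'
        calc η⁻¹ * (η⁻¹ * (η⁻¹ * (Mφ' * ((2 * (η ^ 3 * nJ) + 8 * d * (α * η ^ 2) ^ 2) * (Mφ * ‖f y‖) +
              ∑ κ, η * (2 * (α * η ^ 2) * (Mφ * ‖Df (y, κ)‖) + 2 * (α * η ^ 2) * (Mφ * ‖Df (unshift κ y, κ)‖))))))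
            = (η⁻¹ * η⁻¹ * η⁻¹ * Mφ') * ((2 * (η ^ 3 * nJ) + 8 * d * (α * η ^ 2) ^ 2) * (Mφ * ‖f y‖)) +
              ∑ κ, (η⁻¹ * η⁻¹ * η⁻¹ * Mφ') * (η * (2 * (α * η ^ 2) * (Mφ * ‖Df (y, κ)‖) + 2 * (α * η ^ 2) * (Mφ * ‖Df (unshift κ y, κ)‖))) := by
              have hms : (η⁻¹ * η⁻¹ * η⁻¹ * Mφ') * ∑ κ, (η * (2 * (α * η ^ 2) * (Mφ * ‖Df (y, κ)‖) + 2 * (α * η ^ 2) * (Mφ * ‖Df (unshift κ y, κ)‖))) =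
                  ∑ κ, (η⁻¹ * η⁻¹ * η⁻¹ * Mφ') * (η * (2 * (α * η ^ 2) * (Mφ * ‖Df (y, κ)‖) + 2 * (α * η ^ 2) * (Mφ * ‖Df (unshift κ y, κ)‖))) :=
                Finset.mul_sum _ _ _
              rw [← hms]; ring
          _ = Mφ * Mφ' * ((2 * nJ + 8 * d * α ^ 2 * η) * ‖f y‖) + ∑ κ, Mφ * Mφ' * (2 * α * (‖Df (y, κ)‖ + ‖Df (unshift κ y, κ)‖)) := by
              congr 1
              · field_simp
              · refine Finset.sum_congr rfl fun κ _ => ?_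
                field_simp
          _ = _ := by
              have hms : Mφ * Mφ' * ∑ κ, (2 * α * (‖Df (y, κ)‖ + ‖Df (unshift κ y, κ)‖)) = ∑ κ, Mφ * Mφ' * (2 * α * (‖Df (y, κ)‖ + ‖Df (unshift κ y, κ)‖)) :=
                Finset.mul_sum _ _ _
              have hms2 : 2 * α * ∑ κ, (‖Df (y, κ)‖ + ‖Df (unshift κ y, κ)‖) = ∑ κ, 2 * α * (‖Df (y, κ)‖ + ‖Df (unshift κ y, κ)‖) :=
                Finset.mul_sum _ _ _
              rw [← hms, hms2, ← mul_add]


include hφ hφ' hMφ hMφ' in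
/-- **THE COMMUTATOR BOUND (3.117)∕(3.36)**: at the model transporters `R = Ad(U)`, `S = Ad(U⁻¹)`, `c = η⁻¹`, for `U(b) ∈ U1`, `‖U(∂p) − 1‖ ≤ αη²` and contractions `R`, `S`,
`‖(D*_UD_U(D_Uf(·,ν)))(x) − (D_U(D*_UD_Uf))(x,ν)‖ ≤ M_φM_φ′·[(2‖J_ν(x)‖ + 8dα²η)·‖f(x+e_ν)‖ + 2α·Σ_κ(‖(D_Uf)(x+e_ν,κ)‖ + ‖(D_Uf)(x+e_ν−e_κ,κ)‖)]` — the exact identity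
`B9Eq3117LaplaceDerivCommutator.laplace_covDeriv_sub_covDeriv_laplace` plus `norm_commutator_sum_le`.  With the current window `‖J‖ ≤ α` of (3.36) the right side is
`O(α)·(‖f‖ + ‖D_Uf‖)` near `x + e_ν` — the input of the covariant Hessian row of STOREY H. [folklore]
[cite: Balaban1985BackgroundPropagators, (3.10)–(3.11) p.392, (3.35)–(3.36) p.396, (3.117)–(3.120) p.419, Thm 3.13 p.426] -/
theorem norm_laplace_covDeriv_comm_le (U : Bond d Pd → 𝔸ˣ) (hUb : ∀ b, U b ∈ U1 𝔸) {η α : ℝ} (hη : 0 < η) (hα : 0 ≤ α)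
    (hpl : ∀ κ ν x, ‖((plaqU (fun μ => shiftEquiv (Pd := Pd) μ) (fun μ y => U (y, μ)) κ ν x : 𝔸ˣ) : 𝔸) - 1‖ ≤ α * η ^ 2)
    (hRn : ∀ b w, ‖adTransportW φ U b w‖ ≤ ‖w‖) (hSn : ∀ b w, ‖adTransportW φ (fun b => (U b)⁻¹) b w‖ ≤ ‖w‖)
    (f : TSite d Pd → W) (ν : Fin d) (x : TSite d Pd) :
    ‖covDiv ((η : ℂ)⁻¹) (adTransportW φ fun b => (U b)⁻¹) (covDeriv ((η : ℂ)⁻¹) (adTransportW φ U)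
          (fun y => covDeriv ((η : ℂ)⁻¹) (adTransportW φ U) f (y, ν))) x -
        covDeriv ((η : ℂ)⁻¹) (adTransportW φ U) (covDiv ((η : ℂ)⁻¹) (adTransportW φ fun b => (U b)⁻¹) (covDeriv ((η : ℂ)⁻¹) (adTransportW φ U) f)) (x, ν)‖ ≤
      Mφ * Mφ' * ((2 * ‖J (fun μ => shiftEquiv (Pd := Pd) μ) (fun μ y => U (y, μ)) η ν x‖ + 8 * d * α ^ 2 * η) * ‖f (shift ν x)‖ +
        2 * α * ∑ κ, (‖covDeriv ((η : ℂ)⁻¹) (adTransportW φ U) f (shift ν x, κ)‖ +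
          ‖covDeriv ((η : ℂ)⁻¹) (adTransportW φ U) f (unshift κ (shift ν x), κ)‖)) := by
  rw [B9Eq3117LaplaceDerivCommutator.laplace_covDeriv_sub_covDeriv_laplace _ _ _ (adTransportW_inv_adTransportW' φ U)]
  exact norm_commutator_sum_le φ hφ hφ' hMφ hMφ' U hUb hη hα hpl hRn hSn f ν x

end Model

end Literature.MathematicalPhysics.QuantumFieldTheory.Balaban1983to89.B9Eq3117CommutatorBound

end
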